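/-
Copyright (c) 2026 the pub-hodgecm-mathlib formalisation cell (harness21).  Prover seat hodgecm-mathlib-LH4-p14 (g6), 2026-09-04 — STAGE-1b, dealer∕pen LH4-plan (g13) WORD #80∕#81
«(α′)₂: the missing type-(2) ingredient by name», heir LEAD T20-05 (R-33)(2)(i) (α₂ payer p14, co-hand LH4-p13 (g8)).
-/
import Summits.HodgeConjecture.HodgeConjecture.Theorems.F0P3cDyRamLevelTokenHNF      -- ★ p859056: `latticeInLevel_iff_forall_smul_mulVec_mem` (brings `LatticeInLevel`)
import Literature.NumberTheory.Automorphic.UnitaryLatticeTreeApartment             -- ★ `mem_mapGL_iff`, `pairing_mulVec_mulVec_of_mem_unitary`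
import Literature.NumberTheory.Automorphic.UnitaryLatticeTreeBlockGluing         -- ★ `v_pairing_comm_of_hermitian`
import Summits.HodgeConjecture.HodgeConjecture.Theorems.F0P3cDyRamValueSetSkewLineCriterion   -- ★ p859272 (LH4-p13 (g8), (L-lab-8)): `not_latticeLabelPlus_of_sq_shallow` (the hermitian half, any `g ∈ U(Φ₃)`)
import Summits.HodgeConjecture.HodgeConjecture.Theorems.F0P3cDyRamUniformizerPowerTube        -- ★ `v_pow_eq_exp_neg`
import Literature.NumberTheory.Automorphic.UnitaryGroupQuasiSplitCMDatum                  -- ★ `isUnit_det_antidiagonal_over`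
import Summits.HodgeConjecture.HodgeConjecture.Theorems.F0P3cDyRamStageOneBDefs               -- ★ p859562 DEFS №5: `mcOfRecord` (brings `mstarOfRecord`, ★ #0a `IsRamifiedQuadraticDatum`)
import Summits.HodgeConjecture.HodgeConjecture.Theorems.F0P3cDyRamFourFrameHSideDefsR              -- ★ №2c-R: the place vocabulary (`localNonsplitEquiv`, `IsLocalNormPair`, `UnitaryGroup.PlacesOver`)
import Literature.NumberTheory.Automorphic.LocalUnitaryIntegralLevel                             -- ★ `placeForm_antidiagOne`
import HarnessLib

/-!
# Crux `H413`, line LH4 «(D-RAM) FOUR-FRAME», STAGE-1b — (α′) EIGENLINE-FREE: square level `m_c` from the label at ANY unitary element with a CAYLEY–HAMILTON KERNEL, and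
# the type-(2) letter α₂ reduced to the linear-algebra letter «type-(2) Cayley–Hamilton kernel near 1»

Cell `hodgecm-mathlib` (D-0151), FLOOR 0, crux item H413 = `stmt-HodgeConjecture-24833`, route `HCCMUnconditional`; squad LH4; lane `--supports stmt-HodgeConjecture-24833 --as helper`.
THEOREMS ONLY (no `def`, no instance, no `sorry`, default heartbeats); ★ imports only.  COUNT-NEUTRAL.

WHY.  ★ (L-lab-14) p859653 proves (α′) «shell + LabelPlus ⇒ `X²·M ⊆ ϖ^{m_c}M`» for the SPLIT frames `Γ_b(α, β)` by transporting to ★ p855032's unimodular DIAGONAL frame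
(`T = diag(α, β, 1)`): its §1 cross bound reads an eigen-coordinate.  A type-(2) norm match `T = ι_w δ` (`charpoly(γ_H.1)` without roots in `E_w`) has no such frame (REF5 R5-295 (b)).
This file removes the eigenlines: (I3) the duality half holds for any `T ∈ U(H)` (adjoint `X* = −T⁻¹X`); (I2) the cross bound needs only a linear functional `π` and a quadratic
relation `X²m = s·Xm − p·m` on `M ∩ ker π` (Cayley–Hamilton on a `T`-stable plane) — `|⟨Xy, Xm⟩| ≤ max(|s||ϖ^ℓ|, |p|)`; (I2′) polarisation along `π`; the hermitian half is ★ (L-lab-8)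
p859272 `not_latticeLabelPlus_of_sq_shallow` (any `g ∈ U(Φ₃)`).  HEAD `latticeInLevel_sq_of_shell_of_labelPlus_of_kerCH` = (α′) at ANY `g ∈ U(Φ₃)` given a kernel `(π, s, p)` with
`|s||ϖ|^{ℓ₀}, |p| ≤ |ϖ|^{m_c}`.  §2 COMPOSER `labelPlusClean_typeTwo_of_kerCH (hKer) : ‹α₂ = LH4-p04 (g7)'s letter alphaT2.letter.v1 a1891c2a VERBATIM›` from the ONE remaining
letter **(κ₂)** «TYPE-(2) CAYLEY–HAMILTON KERNEL NEAR 1»: per place, `∃ V ∈ 𝓝 1`, for `G`-regular non-split `γ_H ∈ V` and every norm match `δ`, `∃ π s p`, `X²m = s·Xm − p·m` on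
`ker π` (`X = ι_w δ − 1`) with `|s|·|ϖ|^{d%2} ≤ |ϖ|^{m_c}` and `|p| ≤ |ϖ|^{m_c}` — pure linear algebra + continuity (`ker π` = the `K`-rational `T`-stable plane `ker q(T)`,
`s = tr(T|_P) − 2`, `p = q(1)`, both → 0 as `γ_H → 1`; LH4-p04 (g7)'s C2 dictionary names the plane).
HONEST LABEL.  Count-neutral; α₂ is NOT proved here — it is REDUCED to (κ₂) (a hypothesis); HC_CM is proved only modulo the 7 printed citations (2 remaining named inputs: hLiu418 =
`stmt-HodgeConjecture-24832`, h413 = `stmt-HodgeConjecture-24833`) until rung 0 closes.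

## References
* [Rogawski1990] J. D. Rogawski, *Automorphic Representations of Unitary Groups in Three Variables*, Ann. of Math. Stud. 123 (1990) — §1.10 p. 9; §4.9 Prop. 4.9.1 (b) p. 55.
* [Kottwitz1986BaseChangeUnits] R. E. Kottwitz, *Base change for unit elements of Hecke algebras*, Compositio Math. 60 (1986) — §1 pp. 240–241.
* [Jacobowitz1962] R. Jacobowitz, *Hermitian forms over local fields*, Amer. J. Math. 84 (1962) — §4, §7.
* [Serre1979] J.-P. Serre, *Local Fields*, GTM 67 (1979) — Ch. III §3 Prop. 7.
-/

set_option autoImplicit false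

noncomputable section

namespace Summit.HodgeConjecture.HodgeConjecture.Cruxes.H413.F0P3cDyRamLabelPlusCleanOfKernelCH

open Literature.NumberTheory.Automorphic Literature.NumberTheory.Automorphic.HermitianLattice Literature.NumberTheory.Automorphic.UnitaryGroup
open Literature.NumberTheory.Automorphic.UnitaryLatticeTree
open Summit.HodgeConjecture.HodgeConjecture.Cruxes.H413.F0P3cDyRamFourFrameCensusDefs
open Summit.HodgeConjecture.HodgeConjecture.Cruxes.H413.F0P3cDyRamLevelTokenHNF (latticeInLevel_iff_forall_smul_mulVec_mem)
open Summit.HodgeConjecture.HodgeConjecture.Cruxes.H413.F0P3cDyRamFourFramePieces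
open Summit.HodgeConjecture.HodgeConjecture.Cruxes.H413.F0P3cDyRamStageOneBDefs
open Literature.NumberTheory.Automorphic.UnitaryThreeFourFrame
open Summit.HodgeConjecture.HodgeConjecture.Cruxes.H413.F0P3cDyRamValueSetSkewLineCriterion (not_latticeLabelPlus_of_sq_shallow)
open scoped Valued WithZero Matrix MatrixGroups
open WithZero
open MeasureTheory Measure NumberField IsDedekindDomain Topology Filter
open Literature.NumberTheory.Automorphic.IntegralReduction Literature.NumberTheory.Rogawski1990 Literature.NumberTheory.GaloisRepresentations
open Summit.HodgeConjecture.HodgeConjecture.Cruxes.H413.F0P3cDyRamFourFrameHSideDefs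
open Summit.HodgeConjecture.HodgeConjecture.Cruxes.H413.F0P3cDyRamFourFrameHSideDefsR

variable {K : Type} [Field K] [Valued K ℤᵐ⁰]

omit [Valued K ℤᵐ⁰] in
/-- **THE ADJOINT IDENTITY** `⟨u c, (u − 1) b⟩ = −⟨(u − 1) c, b⟩` for `u ∈ U(σ, H)` — i.e. `(u − 1)* = u⁻¹ − 1 = −u⁻¹(u − 1)`: expand the isometry `⟨uc, ub⟩ = ⟨c, b⟩`.  Any rank,
any form, any `u` in its unitary group. [cite: Jacobowitz1962, §4] [cite: Rogawski1990, §1.10 p. 9] -/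
theorem pairing_mulVec_sub_one_mulVec_eq_neg {N : ℕ} {σ : K →+* K} {H : Matrix (Fin N) (Fin N) K} {u : GL (Fin N) K}
    (hu : u ∈ unitaryGroupOfForm σ H) (c b : Fin N → K) :
    pairing σ H ((u : Matrix (Fin N) (Fin N) K) *ᵥ c) (((u : Matrix (Fin N) (Fin N) K) - 1) *ᵥ b) =
      - pairing σ H (((u : Matrix (Fin N) (Fin N) K) - 1) *ᵥ c) b := by
  rw [Matrix.sub_mulVec, Matrix.sub_mulVec, Matrix.one_mulVec, Matrix.one_mulVec, map_sub, map_sub, LinearMap.sub_apply,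
    pairing_mulVec_mulVec_of_mem_unitary hu]
  ring

/-- **(I3) THE DUALITY HALF, EIGENLINE-FREE** (★ (L-lab-14) §2 `latticeInLevel_sq_of_forall_v_cross_le` for ANY `T ∈ U(σ, H)`, any form `H`): if `M` is self-dual
(`M^♯ = M`), `T·M = M` and every cross value `⟨(T−1)y, (T−1)y′⟩`, `y, y′ ∈ M`, has valuation `≤ |ϖ^m|`, then `(T−1)²·M ⊆ ϖ^m·M` — for `y″ ∈ M` put `c := T⁻¹y″ ∈ M`; the adjoint
identity gives `⟨y″, (T−1)²y⟩ = −⟨(T−1)c, (T−1)y⟩`, so `ϖ^{−m}(T−1)²y ∈ M^♯ = M`. [cite: Jacobowitz1962, §4, §7] [cite: Kottwitz1986BaseChangeUnits, §1 pp. 240–241] -/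
theorem latticeInLevel_mul_self_of_forall_v_pairing_le {σ : K →+* K} {ϖ : K} (hϖ0 : ϖ ≠ 0) {H : Matrix (Fin 3) (Fin 3) K}
    {M : Submodule 𝒪[K] (Fin 3 → K)} (hdual : dualLatt σ H M = M)
    {T : GL (Fin 3) K} (hT : T ∈ unitaryGroupOfForm σ H) (hTM : mapGL T M = M) {m : ℕ}
    (hcross : ∀ y ∈ M, ∀ y' ∈ M,
      Valued.v (pairing σ H (((T : Matrix (Fin 3) (Fin 3) K) - 1) *ᵥ y) (((T : Matrix (Fin 3) (Fin 3) K) - 1) *ᵥ y')) ≤ Valued.v (ϖ ^ m)) :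
    LatticeInLevel ϖ m ((((T : Matrix (Fin 3) (Fin 3) K) - 1)) * ((T : Matrix (Fin 3) (Fin 3) K) - 1)) M := by
  have hϖm : (ϖ ^ m : K) ≠ 0 := pow_ne_zero _ hϖ0
  rw [latticeInLevel_iff_forall_smul_mulVec_mem hϖ0]
  intro y hy
  rw [← hdual, mem_dualLatt]
  intro y'' hy''
  have hc : ((T⁻¹ : GL (Fin 3) K) : Matrix (Fin 3) (Fin 3) K) *ᵥ y'' ∈ M := (mem_mapGL_iff T M y'').1 (hTM.symm ▸ hy'')
  have hTc : (T : Matrix (Fin 3) (Fin 3) K) *ᵥ (((T⁻¹ : GL (Fin 3) K) : Matrix (Fin 3) (Fin 3) K) *ᵥ y'') = y'' := by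
    rw [Matrix.mulVec_mulVec, ← Units.val_mul, mul_inv_cancel, Units.val_one, Matrix.one_mulVec]
  have hcr := hcross _ hc y hy
  have key : pairing σ H y'' ((((ϖ ^ m)⁻¹ • ((((T : Matrix (Fin 3) (Fin 3) K) - 1)) * ((T : Matrix (Fin 3) (Fin 3) K) - 1))) *ᵥ y)) =
      (ϖ ^ m)⁻¹ * -(pairing σ H (((T : Matrix (Fin 3) (Fin 3) K) - 1) *ᵥ (((T⁻¹ : GL (Fin 3) K) : Matrix (Fin 3) (Fin 3) K) *ᵥ y''))
        (((T : Matrix (Fin 3) (Fin 3) K) - 1) *ᵥ y)) := by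
    rw [Matrix.smul_mulVec, map_smul, smul_eq_mul, ← Matrix.mulVec_mulVec, ← pairing_mulVec_sub_one_mulVec_eq_neg hT, hTc]
  rw [key, map_mul, Valuation.map_neg, map_inv₀]
  calc (Valued.v (ϖ ^ m))⁻¹ * Valued.v (pairing σ H (((T : Matrix (Fin 3) (Fin 3) K) - 1) *ᵥ (((T⁻¹ : GL (Fin 3) K) : Matrix (Fin 3) (Fin 3) K) *ᵥ y''))
        (((T : Matrix (Fin 3) (Fin 3) K) - 1) *ᵥ y))
      ≤ (Valued.v (ϖ ^ m))⁻¹ * Valued.v (ϖ ^ m) := mul_le_mul_right hcr _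
    _ = 1 := inv_mul_cancel₀ ((Valuation.ne_zero_iff _).2 hϖm)

/-- **(I2) THE CROSS BOUND ON A CAYLEY–HAMILTON KERNEL, EIGENLINE-FREE** (replaces ★ (L-lab-14) §1 `v_cross_le_of_latticeInLevel`, whose `m₀ = 0` reads an eigen-coordinate).
`T ∈ U(σ, H)`, `X = T − 1`, `h` integral on `M`, `T·M = M`, `X·M ⊆ ϖ^ℓ M`; `π` a linear functional and `s, p` scalars such that ON `M ∩ ker π` the operator satisfies the quadratic
relation `X²m = s·Xm − p·m`.  Then for `y ∈ M` and `m ∈ M ∩ ker π`: `|⟨Xy, Xm⟩| ≤ max(|s|·|ϖ^ℓ|, |p|)` — adjoint: `⟨Xy, Xm⟩ = −⟨Ty, X²m⟩ = −(s⟨Ty, Xm⟩ − p⟨Ty, m⟩)`, with `Ty ∈ M`,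
`ϖ^{−ℓ}Xm ∈ M`.  At a split frame (`π = y₀`, `s = β − 1`, `p = 0`) this is ★'s `|β − 1|·|ϖ^ℓ|`; at a type-(2) (non-split) element, `ker π` = its `K`-rational `T`-stable plane,
`s = tr(T|_P) − 2`, `p = χ_{T|_P}(1)`, both DEEP near `1`. [cite: Kottwitz1986BaseChangeUnits, §1 pp. 240–241] [cite: Jacobowitz1962, §4] -/
theorem v_pairing_sub_one_le_of_apply_eq_zero {σ : K →+* K} {ϖ : K} (hϖ0 : ϖ ≠ 0) {H : Matrix (Fin 3) (Fin 3) K}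
    {M : Submodule 𝒪[K] (Fin 3 → K)} (hint : ∀ y ∈ M, ∀ z ∈ M, Valued.v (pairing σ H y z) ≤ 1)
    {T : GL (Fin 3) K} (hT : T ∈ unitaryGroupOfForm σ H) (hTM : mapGL T M = M) {ℓ : ℕ}
    (hlev : LatticeInLevel ϖ ℓ ((T : Matrix (Fin 3) (Fin 3) K) - 1) M)
    (π : (Fin 3 → K) →ₗ[K] K) {s p : K}
    (hCH : ∀ m ∈ M, π m = 0 → ((T : Matrix (Fin 3) (Fin 3) K) - 1) *ᵥ (((T : Matrix (Fin 3) (Fin 3) K) - 1) *ᵥ m) =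
      s • (((T : Matrix (Fin 3) (Fin 3) K) - 1) *ᵥ m) - p • m)
    {y m : Fin 3 → K} (hy : y ∈ M) (hm : m ∈ M) (hπm : π m = 0) :
    Valued.v (pairing σ H (((T : Matrix (Fin 3) (Fin 3) K) - 1) *ᵥ y) (((T : Matrix (Fin 3) (Fin 3) K) - 1) *ᵥ m)) ≤
      max (Valued.v s * Valued.v (ϖ ^ ℓ)) (Valued.v p) := by
  have hϖl : (ϖ ^ ℓ : K) ≠ 0 := pow_ne_zero _ hϖ0
  -- `T y ∈ M`
  have hTy : (T : Matrix (Fin 3) (Fin 3) K) *ᵥ y ∈ M := by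
    rw [← hTM]; refine (mem_mapGL_iff T M _).2 ?_
    rwa [Matrix.mulVec_mulVec, ← Units.val_mul, inv_mul_cancel, Units.val_one, Matrix.one_mulVec]
  -- `ϖ^{-ℓ} X m ∈ M`
  have hXm : ((ϖ ^ ℓ)⁻¹ • (((T : Matrix (Fin 3) (Fin 3) K) - 1))) *ᵥ m ∈ M := (latticeInLevel_iff_forall_smul_mulVec_mem hϖ0 _ _ _).1 hlev m hm
  rw [Matrix.smul_mulVec] at hXm
  -- adjoint: `⟨X y, X m⟩ = −⟨T y, X (X m)⟩ = −(s·⟨T y, X m⟩ − p·⟨T y, m⟩)`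
  have key : pairing σ H (((T : Matrix (Fin 3) (Fin 3) K) - 1) *ᵥ y) (((T : Matrix (Fin 3) (Fin 3) K) - 1) *ᵥ m) =
      -(s * (ϖ ^ ℓ * pairing σ H ((T : Matrix (Fin 3) (Fin 3) K) *ᵥ y) ((ϖ ^ ℓ)⁻¹ • (((T : Matrix (Fin 3) (Fin 3) K) - 1) *ᵥ m))) -
        p * pairing σ H ((T : Matrix (Fin 3) (Fin 3) K) *ᵥ y) m) := by
    have h1 := pairing_mulVec_sub_one_mulVec_eq_neg hT y (((T : Matrix (Fin 3) (Fin 3) K) - 1) *ᵥ m)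
    rw [hCH m hm hπm, map_sub, map_smul, map_smul, smul_eq_mul, smul_eq_mul] at h1
    rw [map_smul, smul_eq_mul, ← mul_assoc (ϖ ^ ℓ), mul_inv_cancel₀ hϖl, one_mul]
    linear_combination h1
  rw [key, Valuation.map_neg]
  refine (Valuation.map_sub _ _ _).trans (max_le_max ?_ ?_)
  · rw [map_mul, map_mul]
    exact mul_le_mul' le_rfl (mul_le_of_le_one_right' (hint _ hTy _ hXm))
  · rw [map_mul]
    exact mul_le_of_le_one_right' (hint _ hTy _ hm)

/-- **(I2′) POLARISATION ALONG `π`** (★ (L-lab-14) §1 `forall_v_cross_le_of_sq_le`, eigenline-free): hermitian `H`, involutive valuation-preserving `σ`; under the hypotheses of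
(I2), if every SQUARE `⟨Xy, Xy⟩` (`y ∈ M`) has valuation `≤ r` and `|s|·|ϖ^ℓ| ≤ r`, `|p| ≤ r`, then EVERY cross value `⟨Xy, Xy′⟩` (`y, y′ ∈ M`) has valuation `≤ r`: order `|π y′| ≤ |π y|`
(else swap by hermitian symmetry), put `a = π y′ ∕ π y ∈ 𝒪`, `m = y′ − a·y ∈ M ∩ ker π`, and split `⟨Xy, Xy′⟩ = a·⟨Xy, Xy⟩ + ⟨Xy, Xm⟩`.
[cite: Kottwitz1986BaseChangeUnits, §1 pp. 240–241] [cite: Jacobowitz1962, §4] -/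
theorem forall_v_pairing_sub_one_le {σ : K →+* K} (hσσ : ∀ a, σ (σ a) = a) (hvσ : ∀ a, Valued.v (σ a) = Valued.v a)
    {ϖ : K} (hϖ0 : ϖ ≠ 0) {H : Matrix (Fin 3) (Fin 3) K} (hH : ∀ a b, σ (H a b) = H b a)
    {M : Submodule 𝒪[K] (Fin 3 → K)} (hint : ∀ y ∈ M, ∀ z ∈ M, Valued.v (pairing σ H y z) ≤ 1)
    {T : GL (Fin 3) K} (hT : T ∈ unitaryGroupOfForm σ H) (hTM : mapGL T M = M) {ℓ : ℕ}
    (hlev : LatticeInLevel ϖ ℓ ((T : Matrix (Fin 3) (Fin 3) K) - 1) M)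
    (π : (Fin 3 → K) →ₗ[K] K) {s p : K}
    (hCH : ∀ m ∈ M, π m = 0 → ((T : Matrix (Fin 3) (Fin 3) K) - 1) *ᵥ (((T : Matrix (Fin 3) (Fin 3) K) - 1) *ᵥ m) =
      s • (((T : Matrix (Fin 3) (Fin 3) K) - 1) *ᵥ m) - p • m)
    {r : ℤᵐ⁰} (hsq : ∀ y ∈ M, Valued.v (pairing σ H (((T : Matrix (Fin 3) (Fin 3) K) - 1) *ᵥ y) (((T : Matrix (Fin 3) (Fin 3) K) - 1) *ᵥ y)) ≤ r)
    (hs : Valued.v s * Valued.v (ϖ ^ ℓ) ≤ r) (hp : Valued.v p ≤ r) :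
    ∀ y ∈ M, ∀ y' ∈ M,
      Valued.v (pairing σ H (((T : Matrix (Fin 3) (Fin 3) K) - 1) *ᵥ y) (((T : Matrix (Fin 3) (Fin 3) K) - 1) *ᵥ y')) ≤ r := by
  -- the one-sided claim under `|π y'| ≤ |π y|`
  have main : ∀ y ∈ M, ∀ y' ∈ M, Valued.v (π y') ≤ Valued.v (π y) →
      Valued.v (pairing σ H (((T : Matrix (Fin 3) (Fin 3) K) - 1) *ᵥ y) (((T : Matrix (Fin 3) (Fin 3) K) - 1) *ᵥ y')) ≤ r := by
    intro y hy y' hy' hle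
    have hker : ∀ m ∈ M, π m = 0 →
        Valued.v (pairing σ H (((T : Matrix (Fin 3) (Fin 3) K) - 1) *ᵥ y) (((T : Matrix (Fin 3) (Fin 3) K) - 1) *ᵥ m)) ≤ r :=
      fun m hm hπm => (v_pairing_sub_one_le_of_apply_eq_zero hϖ0 hint hT hTM hlev π hCH hy hm hπm).trans (max_le hs hp)
    by_cases hπy : π y = 0
    · have hπy' : π y' = 0 := by
        rw [hπy, map_zero, le_zero_iff] at hle; exact (Valuation.zero_iff _).1 hle
      exact hker y' hy' hπy'
    · -- `a := π y' / π y ∈ 𝒪`, `m := y' − a•y ∈ M ∩ ker π`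
      have ha : Valued.v (π y' / π y) ≤ 1 := by
        rw [map_div₀]; exact div_le_one_of_le₀ hle zero_le
      set a : 𝒪[K] := ⟨π y' / π y, (mem_integer_iff' _).2 ha⟩ with ha_def
      have hm : y' - a • y ∈ M := M.sub_mem hy' (M.smul_mem a hy)
      have hπm : π (y' - a • y) = 0 := by
        rw [map_sub, show a • y = (π y' / π y) • y from rfl, map_smul, smul_eq_mul, div_mul_cancel₀ _ hπy, sub_self]
      have hsplit : ((T : Matrix (Fin 3) (Fin 3) K) - 1) *ᵥ y' =
          (π y' / π y) • (((T : Matrix (Fin 3) (Fin 3) K) - 1) *ᵥ y) + ((T : Matrix (Fin 3) (Fin 3) K) - 1) *ᵥ (y' - a • y) := by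
        rw [show a • y = (π y' / π y) • y from rfl, Matrix.mulVec_sub, Matrix.mulVec_smul]; abel
      rw [hsplit, map_add, map_smul, smul_eq_mul]
      refine (Valuation.map_add _ _ _).trans (max_le ?_ (hker _ hm hπm))
      rw [map_mul]
      calc Valued.v (π y' / π y) * Valued.v (pairing σ H (((T : Matrix (Fin 3) (Fin 3) K) - 1) *ᵥ y) (((T : Matrix (Fin 3) (Fin 3) K) - 1) *ᵥ y))
          ≤ 1 * r := mul_le_mul' ha (hsq y hy)
        _ = r := one_mul r
  intro y hy y' hy'
  rcases le_total (Valued.v (π y')) (Valued.v (π y)) with hle | hle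
  · exact main y hy y' hy' hle
  · rw [v_pairing_comm_of_hermitian hvσ hσσ hH]
    exact main y' hy' y hy hle

/-- **(α′) TYPE-UNIFORM — `latticeInLevel_sq_of_shell_of_labelPlus_of_kerCH`.**  Ramified quadratic datum `(σ, ϖ; d, t)`, `g ∈ U(σ, Φ₃)`, `M` a self-dual (type-0) vertex with `g·M = M`, `X = g − 1` on the
near-transvection shell at `(ℓ₀, m*) = (d % 2, mstarOfRecord d)` with `LatticeLabelPlus`; `π, s, p` a CAYLEY–HAMILTON KERNEL for `X` on `M` (`X²m = s·Xm − p·m` on `M ∩ ker π`) with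
`|s|·|ϖ|^{ℓ₀} ≤ |ϖ|^{m_c}`, `|p| ≤ |ϖ|^{m_c}`, `m_c = mcOfRecord d = 2⌊(m*+d)∕2⌋`.  THEN `X²·M ⊆ ϖ^{m_c}·M`.  Proof: hermitian half ★ (L-lab-8) `not_latticeLabelPlus_of_sq_shallow` (every
square `≤ |ϖ|^{m_c}`, any `g ∈ U(Φ₃)`) ∘ (I2′) ∘ (I3).  No frame, no eigenline, no `IsFourFrameFamily`∕`IsElementDatum`: at a split frame the kernel is `(y₀, β − 1, 0)` and this is
★ (L-lab-14)'s head with its fence; at a type-(2) norm match the kernel is the rational `T`-stable plane — so (α′)₂ ⟸ ONE linear-algebra letter «type-(2) Cayley–Hamilton kernel near 1».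
[cite: Rogawski1990, §4.9 Prop. 4.9.1 (b) p. 55] [cite: Kottwitz1986BaseChangeUnits, §1 pp. 240–241] [cite: Serre1979, Ch. III §3 Prop. 7] -/
theorem latticeInLevel_sq_of_shell_of_labelPlus_of_kerCH {σ : K →+* K} {ϖ : K} {d t : ℕ} (hD : IsRamifiedQuadraticDatum σ ϖ d t)
    {g : GL (Fin 3) K} (hg : g ∈ unitaryGroupOfForm σ ((StdForm.antidiagonal 3).over K))
    {M : Submodule 𝒪[K] (Fin 3 → K)} (hM : IsVertexLattice σ ϖ ((StdForm.antidiagonal 3).over K) 0 M) (hfix : mapGL g M = M)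
    (hshell : LatticeNearTransvShell ϖ (d % 2) (mstarOfRecord d) ((g : Matrix (Fin 3) (Fin 3) K) - 1) M)
    (hlab : LatticeLabelPlus σ ϖ d (mstarOfRecord d) M ((g : Matrix (Fin 3) (Fin 3) K) - 1))
    (π : (Fin 3 → K) →ₗ[K] K) {s p : K}
    (hCH : ∀ m ∈ M, π m = 0 → ((g : Matrix (Fin 3) (Fin 3) K) - 1) *ᵥ (((g : Matrix (Fin 3) (Fin 3) K) - 1) *ᵥ m) =
      s • (((g : Matrix (Fin 3) (Fin 3) K) - 1) *ᵥ m) - p • m)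
    (hs : Valued.v s * Valued.v (ϖ ^ (d % 2)) ≤ Valued.v (ϖ ^ mcOfRecord d)) (hp : Valued.v p ≤ Valued.v (ϖ ^ mcOfRecord d)) :
    LatticeInLevel ϖ (mcOfRecord d) ((((g : Matrix (Fin 3) (Fin 3) K) - 1)) * ((g : Matrix (Fin 3) (Fin 3) K) - 1)) M := by
  obtain ⟨hσ, hvσ, hϖ, hfixv, hd, -, ht⟩ := hD
  have hϖ0 : ϖ ≠ 0 := fun h => by rw [h, map_zero] at hϖ; exact exp_ne_zero hϖ.symm
  have hdual : dualLatt σ ((StdForm.antidiagonal 3).over K) M = M :=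
    dualLatt_eq_self_of_isSelfDualLattice hvσ (UnitaryGroup.isUnit_det_antidiagonal_over K 3) hM
  have hint : ∀ y ∈ M, ∀ z ∈ M, Valued.v (pairing σ ((StdForm.antidiagonal 3).over K) y z) ≤ 1 := fun y hy z hz =>
    (mem_dualLatt σ _ M z).1 (hdual.symm ▸ hz) y hy
  -- the hermitian half (★ (L-lab-8)): every square is `≤ |ϖ|^{m_c}`, `m_c = 2⌊(m* + d)∕2⌋`
  have hsq : ∀ y ∈ M, Valued.v (pairing σ ((StdForm.antidiagonal 3).over K) (((g : Matrix (Fin 3) (Fin 3) K) - 1) *ᵥ y)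
      (((g : Matrix (Fin 3) (Fin 3) K) - 1) *ᵥ y)) ≤ Valued.v (ϖ ^ mcOfRecord d) := by
    intro y hy
    by_contra hlt
    rw [not_le, F0P3cDyRamUniformizerPowerTube.v_pow_eq_exp_neg hϖ] at hlt
    have hn : 2 * (((mstarOfRecord d + d) / 2 : ℕ) : ℤ) ≤ (mstarOfRecord d : ℤ) + d := by omega
    refine not_latticeLabelPlus_of_sq_shallow hσ hfixv hϖ hd ht hg hy hn ?_ hlab
    convert hlt using 3
    unfold mcOfRecord; push_cast; ring
  have hcross := forall_v_pairing_sub_one_le hσ hvσ hϖ0 (map_antidiagonal_three_over_apply_eq (K := K) σ) hint hg hfix hshell.1 π hCH hsq hs hp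
  exact latticeInLevel_mul_self_of_forall_v_pairing_le hϖ0 hdual hg hfix hcross

/-! ## §2  The type-(2) letter α₂ ⟸ the Cayley–Hamilton kernel letter (κ₂) -/

/-- **COMPOSER `labelPlusClean_typeTwo_of_kerCH`** — LH4-p04 (g7)'s letter α₂ (`alphaT2.letter.v1` a1891c2a3d62115c, the `(hLC₂ : …)` binder of ★ `hDelta_ofRecord`) VERBATIM, from
the single letter **(κ₂)** «type-(2) Cayley–Hamilton kernel near 1» (same ∀-place prefix; per `G`-regular non-split `γ_H` near `1` and norm match `δ`: a functional `π` and scalars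
`s, p` with `X²m = s·Xm − p·m` on `ker π`, `X = ι_w δ − 1`, `|s|·|ϖ|^{d%2} ≤ |ϖ|^{m_c}`, `|p| ≤ |ϖ|^{m_c}`).  Proof: §1 HEAD at `g := ι_w δ ∈ U(Φ₃)` (★ `placeForm_antidiagOne`).
[cite: Rogawski1990, §4.9 Prop. 4.9.1 (b) p. 55] [cite: Kottwitz1986BaseChangeUnits, §1 pp. 240–241] -/
theorem labelPlusClean_typeTwo_of_kerCH
    (hKer :
      ∀ (L : Type) [Field L] [NumberField L] [IsCMField L]
        {v : HeightOneSpectrum (𝓞 ↥(maximalRealSubfield L))} (w : UnitaryGroup.PlacesOver L v)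
        (hw : IsCMField.complexConj L • w.1 = w.1) (_he : v.asIdeal.ramificationIdx' w.1.asIdeal ≠ 1)
        (_h2 : ¬ IsUnit (2 : 𝒪[w.1.adicCompletion L]))
        (ϖ : (w.1.adicCompletion L)) (_hϖ : Valued.v ϖ = WithZero.exp (-1 : ℤ)) (d tE : ℕ) (_hD : IsRamifiedQuadraticDatum (galAdicCompletionMap (L := L) (IsCMField.complexConj L) hw) ϖ d tE)
        [Fintype (Valued.ResidueField (w.1.adicCompletion L))] (δ : (w.1.adicCompletion L)) (_hδ : (galAdicCompletionMap (L := L) (IsCMField.complexConj L) hw) δ = -δ) (_hδ0 : δ ≠ 0)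
        (μ : HeckeCharacter L) (_hμu : μ.IsUnitary)
        (_hμω : ∀ x : ideleGroup ↥(maximalRealSubfield L), μ (AdeleRing.ideleBaseChange ↥(maximalRealSubfield L) L x) = quadraticHeckeCharCM L x)
        [MeasurableSpace ((UnitaryGroup.cmDatum L 3 (Matrix.of fun i j : Fin 3 => if i.val + j.val + 1 = 3 then (1 : L) else 0)).Local v)] [BorelSpace ((UnitaryGroup.cmDatum L 3 (Matrix.of fun i j : Fin 3 => if i.val + j.val + 1 = 3 then (1 : L) else 0)).Local v)]
        [∀ γ : ((UnitaryGroup.cmDatum L 3 (Matrix.of fun i j : Fin 3 => if i.val + j.val + 1 = 3 then (1 : L) else 0)).Local v), MeasurableSpace (((UnitaryGroup.cmDatum L 3 (Matrix.of fun i j : Fin 3 => if i.val + j.val + 1 = 3 then (1 : L) else 0)).Local v) ⧸ Subgroup.centralizer ({γ} : Set ((UnitaryGroup.cmDatum L 3 (Matrix.of fun i j : Fin 3 => if i.val + j.val + 1 = 3 then (1 : L) else 0)).Local v)))]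
        [∀ γ : ((UnitaryGroup.cmDatum L 3 (Matrix.of fun i j : Fin 3 => if i.val + j.val + 1 = 3 then (1 : L) else 0)).Local v), BorelSpace (((UnitaryGroup.cmDatum L 3 (Matrix.of fun i j : Fin 3 => if i.val + j.val + 1 = 3 then (1 : L) else 0)).Local v) ⧸ Subgroup.centralizer ({γ} : Set ((UnitaryGroup.cmDatum L 3 (Matrix.of fun i j : Fin 3 => if i.val + j.val + 1 = 3 then (1 : L) else 0)).Local v)))]
        [MeasurableSpace ((UnitaryGroup.cmDatum L 2 (Matrix.of fun i j : Fin 2 => if i.val + j.val + 1 = 2 then (1 : L) else 0)).Local v × (UnitaryGroup.cmDatum L 1 (Matrix.of fun i j : Fin 1 => if i.val + j.val + 1 = 1 then (1 : L) else 0)).Local v)] [BorelSpace ((UnitaryGroup.cmDatum L 2 (Matrix.of fun i j : Fin 2 => if i.val + j.val + 1 = 2 then (1 : L) else 0)).Local v × (UnitaryGroup.cmDatum L 1 (Matrix.of fun i j : Fin 1 => if i.val + j.val + 1 = 1 then (1 : L) else 0)).Local v)]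
        [∀ a : ((UnitaryGroup.cmDatum L 2 (Matrix.of fun i j : Fin 2 => if i.val + j.val + 1 = 2 then (1 : L) else 0)).Local v × (UnitaryGroup.cmDatum L 1 (Matrix.of fun i j : Fin 1 => if i.val + j.val + 1 = 1 then (1 : L) else 0)).Local v), MeasurableSpace (((UnitaryGroup.cmDatum L 2 (Matrix.of fun i j : Fin 2 => if i.val + j.val + 1 = 2 then (1 : L) else 0)).Local v × (UnitaryGroup.cmDatum L 1 (Matrix.of fun i j : Fin 1 => if i.val + j.val + 1 = 1 then (1 : L) else 0)).Local v) ⧸ Subgroup.centralizer ({a} : Set ((UnitaryGroup.cmDatum L 2 (Matrix.of fun i j : Fin 2 => if i.val + j.val + 1 = 2 then (1 : L) else 0)).Local v × (UnitaryGroup.cmDatum L 1 (Matrix.of fun i j : Fin 1 => if i.val + j.val + 1 = 1 then (1 : L) else 0)).Local v)))]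
        [∀ a : ((UnitaryGroup.cmDatum L 2 (Matrix.of fun i j : Fin 2 => if i.val + j.val + 1 = 2 then (1 : L) else 0)).Local v × (UnitaryGroup.cmDatum L 1 (Matrix.of fun i j : Fin 1 => if i.val + j.val + 1 = 1 then (1 : L) else 0)).Local v), BorelSpace (((UnitaryGroup.cmDatum L 2 (Matrix.of fun i j : Fin 2 => if i.val + j.val + 1 = 2 then (1 : L) else 0)).Local v × (UnitaryGroup.cmDatum L 1 (Matrix.of fun i j : Fin 1 => if i.val + j.val + 1 = 1 then (1 : L) else 0)).Local v) ⧸ Subgroup.centralizer ({a} : Set ((UnitaryGroup.cmDatum L 2 (Matrix.of fun i j : Fin 2 => if i.val + j.val + 1 = 2 then (1 : L) else 0)).Local v × (UnitaryGroup.cmDatum L 1 (Matrix.of fun i j : Fin 1 => if i.val + j.val + 1 = 1 then (1 : L) else 0)).Local v)))]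
        (νH : Measure ((UnitaryGroup.cmDatum L 2 (Matrix.of fun i j : Fin 2 => if i.val + j.val + 1 = 2 then (1 : L) else 0)).Local v × (UnitaryGroup.cmDatum L 1 (Matrix.of fun i j : Fin 1 => if i.val + j.val + 1 = 1 then (1 : L) else 0)).Local v)) [νH.IsHaarMeasure] [νH.IsMulRightInvariant]
        (νG₃ : Measure ((UnitaryGroup.cmDatum L 3 (Matrix.of fun i j : Fin 3 => if i.val + j.val + 1 = 3 then (1 : L) else 0)).Local v)) [νG₃.IsHaarMeasure] [νG₃.IsMulRightInvariant]
        (mH : OrbitalMeasureFamily ((UnitaryGroup.cmDatum L 2 (Matrix.of fun i j : Fin 2 => if i.val + j.val + 1 = 2 then (1 : L) else 0)).Local v × (UnitaryGroup.cmDatum L 1 (Matrix.of fun i j : Fin 1 => if i.val + j.val + 1 = 1 then (1 : L) else 0)).Local v)) (mG₃ : OrbitalMeasureFamily ((UnitaryGroup.cmDatum L 3 (Matrix.of fun i j : Fin 3 => if i.val + j.val + 1 = 3 then (1 : L) else 0)).Local v))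
        (_hmH : mH.IsCanonical (IsLocalGRegular L v) νH) (_hmG : mG₃.IsCanonical (fun γ => IsRegularElt (γ.val : GL (Fin 3) (UnitaryGroup.LocalRing L v))) νG₃),
                                    (∃ V ∈ 𝓝 (1 : ((UnitaryGroup.cmDatum L 2 (Matrix.of fun i j : Fin 2 => if i.val + j.val + 1 = 2 then (1 : L) else 0)).Local v × (UnitaryGroup.cmDatum L 1 (Matrix.of fun i j : Fin 1 => if i.val + j.val + 1 = 1 then (1 : L) else 0)).Local v)), ∀ γH ∈ V, IsLocalGRegular L v γH →
      ¬ (∃ x : (w.1.adicCompletion L), (((((γH).1.val : GL (Fin 2) (UnitaryGroup.LocalRing L v)).val.map (Pi.evalRingHom (fun w' : UnitaryGroup.PlacesOver L v => w'.1.adicCompletion L) w))).charpoly).IsRoot x) →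
      ∀ δ : ((UnitaryGroup.cmDatum L 3 (Matrix.of fun i j : Fin 3 => if i.val + j.val + 1 = 3 then (1 : L) else 0)).Local v), IsLocalNormPair L (Matrix.of fun i j : Fin 3 => if i.val + j.val + 1 = 3 then (1 : L) else 0) v γH δ →
        ∃ (π : (Fin 3 → (w.1.adicCompletion L)) →ₗ[w.1.adicCompletion L] (w.1.adicCompletion L)) (s p : (w.1.adicCompletion L)),
          (∀ m : Fin 3 → (w.1.adicCompletion L), π m = 0 →
            ((((localNonsplitEquiv (IsCMField.complexConj L) (Matrix.of fun i j : Fin 3 => if i.val + j.val + 1 = 3 then (1 : L) else 0) (IsCMField.complexConj_ne_one L) w hw δ :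
              ↥(unitaryGroupOfForm (galAdicCompletionMap (L := L) (IsCMField.complexConj L) hw) (placeForm (Matrix.of fun i j : Fin 3 => if i.val + j.val + 1 = 3 then (1 : L) else 0) w.1))) : GL (Fin 3) (w.1.adicCompletion L)) : Matrix (Fin 3) (Fin 3) (w.1.adicCompletion L)) - 1) *ᵥ (((((localNonsplitEquiv (IsCMField.complexConj L) (Matrix.of fun i j : Fin 3 => if i.val + j.val + 1 = 3 then (1 : L) else 0) (IsCMField.complexConj_ne_one L) w hw δ :
              ↥(unitaryGroupOfForm (galAdicCompletionMap (L := L) (IsCMField.complexConj L) hw) (placeForm (Matrix.of fun i j : Fin 3 => if i.val + j.val + 1 = 3 then (1 : L) else 0) w.1))) : GL (Fin 3) (w.1.adicCompletion L)) : Matrix (Fin 3) (Fin 3) (w.1.adicCompletion L)) - 1) *ᵥ m) =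
              s • (((((localNonsplitEquiv (IsCMField.complexConj L) (Matrix.of fun i j : Fin 3 => if i.val + j.val + 1 = 3 then (1 : L) else 0) (IsCMField.complexConj_ne_one L) w hw δ :
              ↥(unitaryGroupOfForm (galAdicCompletionMap (L := L) (IsCMField.complexConj L) hw) (placeForm (Matrix.of fun i j : Fin 3 => if i.val + j.val + 1 = 3 then (1 : L) else 0) w.1))) : GL (Fin 3) (w.1.adicCompletion L)) : Matrix (Fin 3) (Fin 3) (w.1.adicCompletion L)) - 1) *ᵥ m) - p • m) ∧
          Valued.v s * Valued.v (ϖ ^ (d % 2)) ≤ Valued.v (ϖ ^ mcOfRecord d) ∧ Valued.v p ≤ Valued.v (ϖ ^ mcOfRecord d))) :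
      ∀ (L : Type) [Field L] [NumberField L] [IsCMField L]
        {v : HeightOneSpectrum (𝓞 ↥(maximalRealSubfield L))} (w : UnitaryGroup.PlacesOver L v)
        (hw : IsCMField.complexConj L • w.1 = w.1) (_he : v.asIdeal.ramificationIdx' w.1.asIdeal ≠ 1)
        (_h2 : ¬ IsUnit (2 : 𝒪[w.1.adicCompletion L]))
        (ϖ : (w.1.adicCompletion L)) (_hϖ : Valued.v ϖ = WithZero.exp (-1 : ℤ)) (d tE : ℕ) (_hD : IsRamifiedQuadraticDatum (galAdicCompletionMap (L := L) (IsCMField.complexConj L) hw) ϖ d tE)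
        [Fintype (Valued.ResidueField (w.1.adicCompletion L))] (δ : (w.1.adicCompletion L)) (_hδ : (galAdicCompletionMap (L := L) (IsCMField.complexConj L) hw) δ = -δ) (_hδ0 : δ ≠ 0)
        (μ : HeckeCharacter L) (_hμu : μ.IsUnitary)
        (_hμω : ∀ x : ideleGroup ↥(maximalRealSubfield L), μ (AdeleRing.ideleBaseChange ↥(maximalRealSubfield L) L x) = quadraticHeckeCharCM L x)
        [MeasurableSpace ((UnitaryGroup.cmDatum L 3 (Matrix.of fun i j : Fin 3 => if i.val + j.val + 1 = 3 then (1 : L) else 0)).Local v)] [BorelSpace ((UnitaryGroup.cmDatum L 3 (Matrix.of fun i j : Fin 3 => if i.val + j.val + 1 = 3 then (1 : L) else 0)).Local v)]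
        [∀ γ : ((UnitaryGroup.cmDatum L 3 (Matrix.of fun i j : Fin 3 => if i.val + j.val + 1 = 3 then (1 : L) else 0)).Local v), MeasurableSpace (((UnitaryGroup.cmDatum L 3 (Matrix.of fun i j : Fin 3 => if i.val + j.val + 1 = 3 then (1 : L) else 0)).Local v) ⧸ Subgroup.centralizer ({γ} : Set ((UnitaryGroup.cmDatum L 3 (Matrix.of fun i j : Fin 3 => if i.val + j.val + 1 = 3 then (1 : L) else 0)).Local v)))]
        [∀ γ : ((UnitaryGroup.cmDatum L 3 (Matrix.of fun i j : Fin 3 => if i.val + j.val + 1 = 3 then (1 : L) else 0)).Local v), BorelSpace (((UnitaryGroup.cmDatum L 3 (Matrix.of fun i j : Fin 3 => if i.val + j.val + 1 = 3 then (1 : L) else 0)).Local v) ⧸ Subgroup.centralizer ({γ} : Set ((UnitaryGroup.cmDatum L 3 (Matrix.of fun i j : Fin 3 => if i.val + j.val + 1 = 3 then (1 : L) else 0)).Local v)))]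
        [MeasurableSpace ((UnitaryGroup.cmDatum L 2 (Matrix.of fun i j : Fin 2 => if i.val + j.val + 1 = 2 then (1 : L) else 0)).Local v × (UnitaryGroup.cmDatum L 1 (Matrix.of fun i j : Fin 1 => if i.val + j.val + 1 = 1 then (1 : L) else 0)).Local v)] [BorelSpace ((UnitaryGroup.cmDatum L 2 (Matrix.of fun i j : Fin 2 => if i.val + j.val + 1 = 2 then (1 : L) else 0)).Local v × (UnitaryGroup.cmDatum L 1 (Matrix.of fun i j : Fin 1 => if i.val + j.val + 1 = 1 then (1 : L) else 0)).Local v)]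
        [∀ a : ((UnitaryGroup.cmDatum L 2 (Matrix.of fun i j : Fin 2 => if i.val + j.val + 1 = 2 then (1 : L) else 0)).Local v × (UnitaryGroup.cmDatum L 1 (Matrix.of fun i j : Fin 1 => if i.val + j.val + 1 = 1 then (1 : L) else 0)).Local v), MeasurableSpace (((UnitaryGroup.cmDatum L 2 (Matrix.of fun i j : Fin 2 => if i.val + j.val + 1 = 2 then (1 : L) else 0)).Local v × (UnitaryGroup.cmDatum L 1 (Matrix.of fun i j : Fin 1 => if i.val + j.val + 1 = 1 then (1 : L) else 0)).Local v) ⧸ Subgroup.centralizer ({a} : Set ((UnitaryGroup.cmDatum L 2 (Matrix.of fun i j : Fin 2 => if i.val + j.val + 1 = 2 then (1 : L) else 0)).Local v × (UnitaryGroup.cmDatum L 1 (Matrix.of fun i j : Fin 1 => if i.val + j.val + 1 = 1 then (1 : L) else 0)).Local v)))]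
        [∀ a : ((UnitaryGroup.cmDatum L 2 (Matrix.of fun i j : Fin 2 => if i.val + j.val + 1 = 2 then (1 : L) else 0)).Local v × (UnitaryGroup.cmDatum L 1 (Matrix.of fun i j : Fin 1 => if i.val + j.val + 1 = 1 then (1 : L) else 0)).Local v), BorelSpace (((UnitaryGroup.cmDatum L 2 (Matrix.of fun i j : Fin 2 => if i.val + j.val + 1 = 2 then (1 : L) else 0)).Local v × (UnitaryGroup.cmDatum L 1 (Matrix.of fun i j : Fin 1 => if i.val + j.val + 1 = 1 then (1 : L) else 0)).Local v) ⧸ Subgroup.centralizer ({a} : Set ((UnitaryGroup.cmDatum L 2 (Matrix.of fun i j : Fin 2 => if i.val + j.val + 1 = 2 then (1 : L) else 0)).Local v × (UnitaryGroup.cmDatum L 1 (Matrix.of fun i j : Fin 1 => if i.val + j.val + 1 = 1 then (1 : L) else 0)).Local v)))]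
        (νH : Measure ((UnitaryGroup.cmDatum L 2 (Matrix.of fun i j : Fin 2 => if i.val + j.val + 1 = 2 then (1 : L) else 0)).Local v × (UnitaryGroup.cmDatum L 1 (Matrix.of fun i j : Fin 1 => if i.val + j.val + 1 = 1 then (1 : L) else 0)).Local v)) [νH.IsHaarMeasure] [νH.IsMulRightInvariant]
        (νG₃ : Measure ((UnitaryGroup.cmDatum L 3 (Matrix.of fun i j : Fin 3 => if i.val + j.val + 1 = 3 then (1 : L) else 0)).Local v)) [νG₃.IsHaarMeasure] [νG₃.IsMulRightInvariant]
        (mH : OrbitalMeasureFamily ((UnitaryGroup.cmDatum L 2 (Matrix.of fun i j : Fin 2 => if i.val + j.val + 1 = 2 then (1 : L) else 0)).Local v × (UnitaryGroup.cmDatum L 1 (Matrix.of fun i j : Fin 1 => if i.val + j.val + 1 = 1 then (1 : L) else 0)).Local v)) (mG₃ : OrbitalMeasureFamily ((UnitaryGroup.cmDatum L 3 (Matrix.of fun i j : Fin 3 => if i.val + j.val + 1 = 3 then (1 : L) else 0)).Local v))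
        (_hmH : mH.IsCanonical (IsLocalGRegular L v) νH) (_hmG : mG₃.IsCanonical (fun γ => IsRegularElt (γ.val : GL (Fin 3) (UnitaryGroup.LocalRing L v))) νG₃),
                                    (∃ V ∈ 𝓝 (1 : ((UnitaryGroup.cmDatum L 2 (Matrix.of fun i j : Fin 2 => if i.val + j.val + 1 = 2 then (1 : L) else 0)).Local v × (UnitaryGroup.cmDatum L 1 (Matrix.of fun i j : Fin 1 => if i.val + j.val + 1 = 1 then (1 : L) else 0)).Local v)), ∀ γH ∈ V, IsLocalGRegular L v γH →
      ¬ (∃ x : (w.1.adicCompletion L), (((((γH).1.val : GL (Fin 2) (UnitaryGroup.LocalRing L v)).val.map (Pi.evalRingHom (fun w' : UnitaryGroup.PlacesOver L v => w'.1.adicCompletion L) w))).charpoly).IsRoot x) →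
      ∀ δ : ((UnitaryGroup.cmDatum L 3 (Matrix.of fun i j : Fin 3 => if i.val + j.val + 1 = 3 then (1 : L) else 0)).Local v), IsLocalNormPair L (Matrix.of fun i j : Fin 3 => if i.val + j.val + 1 = 3 then (1 : L) else 0) v γH δ →
        ∀ M : Submodule (Valued.integer (w.1.adicCompletion L)) (Fin 3 → w.1.adicCompletion L), IsVertexLattice (galAdicCompletionMap (L := L) (IsCMField.complexConj L) hw) ϖ ((StdForm.antidiagonal 3).over (w.1.adicCompletion L)) 0 M →
          mapGL ((localNonsplitEquiv (IsCMField.complexConj L) (Matrix.of fun i j : Fin 3 => if i.val + j.val + 1 = 3 then (1 : L) else 0) (IsCMField.complexConj_ne_one L) w hw δ :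
              ↥(unitaryGroupOfForm (galAdicCompletionMap (L := L) (IsCMField.complexConj L) hw) (placeForm (Matrix.of fun i j : Fin 3 => if i.val + j.val + 1 = 3 then (1 : L) else 0) w.1))) : GL (Fin 3) (w.1.adicCompletion L)) M = M →
          LatticeNearTransvShell ϖ (d % 2) (mstarOfRecord d) ((((localNonsplitEquiv (IsCMField.complexConj L) (Matrix.of fun i j : Fin 3 => if i.val + j.val + 1 = 3 then (1 : L) else 0) (IsCMField.complexConj_ne_one L) w hw δ :
              ↥(unitaryGroupOfForm (galAdicCompletionMap (L := L) (IsCMField.complexConj L) hw) (placeForm (Matrix.of fun i j : Fin 3 => if i.val + j.val + 1 = 3 then (1 : L) else 0) w.1))) : GL (Fin 3) (w.1.adicCompletion L)) : Matrix (Fin 3) (Fin 3) (w.1.adicCompletion L)) - 1) M →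
          LatticeLabelPlus (galAdicCompletionMap (L := L) (IsCMField.complexConj L) hw) ϖ d (mstarOfRecord d) M ((((localNonsplitEquiv (IsCMField.complexConj L) (Matrix.of fun i j : Fin 3 => if i.val + j.val + 1 = 3 then (1 : L) else 0) (IsCMField.complexConj_ne_one L) w hw δ :
              ↥(unitaryGroupOfForm (galAdicCompletionMap (L := L) (IsCMField.complexConj L) hw) (placeForm (Matrix.of fun i j : Fin 3 => if i.val + j.val + 1 = 3 then (1 : L) else 0) w.1))) : GL (Fin 3) (w.1.adicCompletion L)) : Matrix (Fin 3) (Fin 3) (w.1.adicCompletion L)) - 1) →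
          LatticeInLevel ϖ (mcOfRecord d) (((((localNonsplitEquiv (IsCMField.complexConj L) (Matrix.of fun i j : Fin 3 => if i.val + j.val + 1 = 3 then (1 : L) else 0) (IsCMField.complexConj_ne_one L) w hw δ :
              ↥(unitaryGroupOfForm (galAdicCompletionMap (L := L) (IsCMField.complexConj L) hw) (placeForm (Matrix.of fun i j : Fin 3 => if i.val + j.val + 1 = 3 then (1 : L) else 0) w.1))) : GL (Fin 3) (w.1.adicCompletion L)) : Matrix (Fin 3) (Fin 3) (w.1.adicCompletion L)) - 1) * ((((localNonsplitEquiv (IsCMField.complexConj L) (Matrix.of fun i j : Fin 3 => if i.val + j.val + 1 = 3 then (1 : L) else 0) (IsCMField.complexConj_ne_one L) w hw δ :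
              ↥(unitaryGroupOfForm (galAdicCompletionMap (L := L) (IsCMField.complexConj L) hw) (placeForm (Matrix.of fun i j : Fin 3 => if i.val + j.val + 1 = 3 then (1 : L) else 0) w.1))) : GL (Fin 3) (w.1.adicCompletion L)) : Matrix (Fin 3) (Fin 3) (w.1.adicCompletion L)) - 1)) M) := by
  intro L _i1 _i2 _i3 v w hw he h2u ϖ hϖ d tE hD _iF δ₀ hδ₀ hδ₀0 μ hμu hμω _i4 _i5 _i6 _i7 _i8 _i9 _i10 _i11 νH _i12 _i13 νG₃ _i14 _i15 mH mG₃ hmH hmG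
  obtain ⟨V, hV, h⟩ := hKer L w hw he h2u ϖ hϖ d tE hD δ₀ hδ₀ hδ₀0 μ hμu hμω νH νG₃ mH mG₃ hmH hmG
  refine ⟨V, hV, ?_⟩
  intro γH hγ hreg hns δ hδ M hM hfix hshell hlab
  obtain ⟨π, s, p, hCH, hs, hp⟩ := h γH hγ hreg hns δ hδ
  have hg : ((localNonsplitEquiv (IsCMField.complexConj L) (Matrix.of fun i j : Fin 3 => if i.val + j.val + 1 = 3 then (1 : L) else 0)
      (IsCMField.complexConj_ne_one L) w hw δ : ↥(unitaryGroupOfForm (galAdicCompletionMap (L := L) (IsCMField.complexConj L) hw)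
        (placeForm (Matrix.of fun i j : Fin 3 => if i.val + j.val + 1 = 3 then (1 : L) else 0) w.1))) : GL (Fin 3) (w.1.adicCompletion L)) ∈
      unitaryGroupOfForm (galAdicCompletionMap (L := L) (IsCMField.complexConj L) hw) ((StdForm.antidiagonal 3).over (w.1.adicCompletion L)) := by
    rw [← placeForm_antidiagOne]
    exact (localNonsplitEquiv (IsCMField.complexConj L) (Matrix.of fun i j : Fin 3 => if i.val + j.val + 1 = 3 then (1 : L) else 0)
      (IsCMField.complexConj_ne_one L) w hw δ).2
  exact latticeInLevel_sq_of_shell_of_labelPlus_of_kerCH hD hg hM hfix hshell hlab π (fun m _ hπ => hCH m hπ) hs hp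

end Summit.HodgeConjecture.HodgeConjecture.Cruxes.H413.F0P3cDyRamLabelPlusCleanOfKernelCH

end
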